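import Literature.NumberTheory.Automorphic.WhittakerTowerDerivative
import Literature.NumberTheory.Automorphic.JPSSProjectedGlobalIntegral

/-!
# The orbit form of the sup bound for the partial Whittaker transforms `Φ_d`

Summit `Langlands`, sub-problem `Langlands`, helper file under `Theorems/` supporting the crux
`PairLBoundaryJS` (stmt-Langlands-13622), line `Sketch`, wave 4 (decay road), registered stub
`stub_decay_orbit_bound` (E4). For the partial Whittaker transforms
`Φ_d = T_{d+1} (T_{d+2} (⋯ (T_{n-1} φ)))` of `WhittakerTower` (`whittakerDepth d φ`; each column
transform `T_c f (g) = μ(box_c)⁻¹ ∫_{box_c} f(y g) conj ψ(y_{c-1,c}) dy` is a normalised average over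
Tate's box of the column group `Y_c(𝔸_K)` against a character of modulus one) we prove the ORBIT
form of the sup bound `norm_whittakerDepth_le` of `WhittakerTowerDerivative`: there is a compact set
`𝒞 ∋ 1` of upper unitriangular matrices whose columns `j ≤ d` are the standard basis vectors such
that, for every `φ`, `g` and real `c`,

  `(∀ u ∈ 𝒞, ‖φ (u g)‖ ≤ c) → ‖Φ_d(g)‖ ≤ c`.

The set is `𝒞 = {1} · S_{n-1} · S_{n-2} ⋯ S_{d+1}` with `S_c ⊆ Y_c(𝔸_K)` the image in `GL_n(𝔸_K)` of the
(compact) closure of the box of `Y_c(𝔸_K)`, built along the recursion of `whittakerIter`; it lies in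
the column-range group `U_{[d+1, n-1]}(𝔸_K)`, whose columns `j ≤ d` are trivial. The bound is the
induction of `norm_whittakerIter_le` with a `g`-dependent bound: `‖T_c F (g)‖ ≤ sup_{y ∈ box_c} ‖F(y g)‖`
and `𝒞_k · S_c ⊆ 𝒞_{k+1}`. This is the step "the integrals defining `W_φ` are over compact sets" of
the estimates of Whittaker functions by the form (Moeglin–Waldspurger (1995), I.2.10–I.2.11;
Cogdell (2004), §1.1, proof of Thm. 1.1).

## References

* C. Moeglin, J.-L. Waldspurger, *Spectral decomposition and Eisenstein series* (1995), I.2.10,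
  I.2.11 [MoeglinWaldspurger1995].
* J. W. Cogdell, *Analytic theory of L-functions for GL_n*, in *An Introduction to the Langlands
  Program* (2004), §1.1, Thm. 1.1 [CogdellAnalyticTheory2004].
-/

noncomputable section

-- `Summit.Langlands.Langlands.…` (summit = sub-problem name, D-0017 layout) trips `dupNamespace`
set_option linter.dupNamespace false

open scoped MatrixGroups Topology Pointwise ENNReal NNReal ComplexConjugate
open scoped Classical Matrix.Norms.Operator
open NumberField IsDedekindDomain MeasureTheory Measure Matrix Set Filter
open Literature.NumberTheory.Automorphic AdelicGroupData

-- the house local instances, exactly as in `RankinSelbergUnfoldingIdentity`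
attribute [local instance] adelicBorel borelSpace_adelic locallyCompactSpace_adelic secondCountableTopology_gl_adelic
  glAdeleBorel borelSpace_glAdele borelSpace_ideleGroup secondCountableTopology_ideleGroup

namespace Summit.Langlands.Langlands.Theorems.GapDecayOrbitBound

section Main

variable {n : ℕ} {K : Type} [Field K] [NumberField K]

local notation "𝔸" => AdeleRing (𝓞 K) K

/-- **`‖T_c f (g)‖ ≤ M` if `‖f (y g)‖ ≤ M` on the box** (`0 ≤ M`): the column transform is a
normalised average over Tate's box against a character of modulus one (the pointwise form of
`norm_colTransform_le`; Cogdell (2004), §1.1). [folklore] -/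
theorem norm_colTransform_le_of_box (c : ℕ) (hc : c < n) (hc0 : 0 < c)
    {f : GL (Fin n) 𝔸 → ℂ} {M : ℝ} (hM0 : 0 ≤ M) (g : GL (Fin n) 𝔸)
    (hM : ∀ y ∈ colRangeTateDomain n K c c, ‖f ((y : GL (Fin n) 𝔸) * g)‖ ≤ M) :
    ‖colTransform (K := K) c hc hc0 f g‖ ≤ M := by
  set μ : Measure ↥(adelicColRange n K c c) := Measure.haar with hμ
  set box := colRangeTateDomain n K c c with hbox
  have hboxfin : μ box < ⊤ := measure_colRangeTateDomain_lt_top μ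
  have hint : ‖∫ y in box, colIntegrand c hc hc0 f g y ∂μ‖ ≤ M * (μ box).toReal := by
    refine norm_setIntegral_le_of_norm_le_const hboxfin fun y hy => ?_
    unfold colIntegrand
    rw [norm_mul, norm_colCharFactor c hc hc0, mul_one]
    exact hM y hy
  rw [colTransform_eq, norm_smul, norm_inv, Real.norm_of_nonneg ENNReal.toReal_nonneg]
  rcases eq_or_ne (μ box).toReal 0 with h0 | h0
  · rw [h0, _root_.inv_zero, zero_mul]; exact hM0
  · calc (μ box).toReal⁻¹ * ‖∫ y in box, colIntegrand c hc hc0 f g y ∂μ‖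
        ≤ (μ box).toReal⁻¹ * (M * (μ box).toReal) :=
          mul_le_mul_of_nonneg_left hint (inv_nonneg.2 ENNReal.toReal_nonneg)
      _ = M := by field_simp

/-- **The orbit sets `𝒞_k` of `whittakerIter k`.** For every `k` there is a compact
`𝒞 ⊆ U_{[n-k, n-1]}(𝔸_K)` containing `1` with `(∀ u ∈ 𝒞, ‖φ (u g)‖ ≤ c) → ‖whittakerIter k φ g‖ ≤ c`
for all `φ`, `g`, `c` (induction on `k`: `𝒞_0 = {1}`, `𝒞_{k+1} = 𝒞_k · S_{n-(k+1)}` with `S_c` the image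
of the closure of the box of `Y_c(𝔸_K)`, and `‖T_c F (g)‖ ≤ sup_{y ∈ box_c} ‖F (y g)‖`, the induction
hypothesis being applied at the points `y g`; Cogdell (2004), §1.1). [folklore] -/
theorem exists_orbit_set_whittakerIter (k : ℕ) :
    ∃ 𝒞 : Set (GL (Fin n) 𝔸), IsCompact 𝒞 ∧ (1 : GL (Fin n) 𝔸) ∈ 𝒞 ∧
      𝒞 ⊆ (adelicColRange n K (n - k) (n - 1) : Set (GL (Fin n) 𝔸)) ∧
      ∀ (φ : GL (Fin n) 𝔸 → ℂ) (g : GL (Fin n) 𝔸) (c : ℝ),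
        (∀ u ∈ 𝒞, ‖φ (u * g)‖ ≤ c) → ‖whittakerIter k φ g‖ ≤ c := by
  induction k with
  | zero =>
    refine ⟨{1}, isCompact_singleton, Set.mem_singleton _, ?_, fun φ g c h => ?_⟩
    · exact Set.singleton_subset_iff.2 (Subgroup.one_mem _)
    · have h1 := h 1 (Set.mem_singleton _)
      rw [one_mul] at h1
      exact h1
  | succ k ih =>
    obtain ⟨𝒞, h𝒞c, h𝒞1, h𝒞U, h𝒞b⟩ := ih
    by_cases h : n - (k + 1) < n ∧ 0 < n - (k + 1)
    · -- `𝒞_{k+1} = 𝒞_k · S_{n-(k+1)}`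
      set S : Set (GL (Fin n) 𝔸) :=
        ((↑) : ↥(adelicColRange n K (n - (k + 1)) (n - (k + 1))) → GL (Fin n) 𝔸) ''
          closure (colRangeTateDomain n K (n - (k + 1)) (n - (k + 1))) with hS
      have hSc : IsCompact S := isCompact_closure_colRangeTateDomain.image continuous_subtype_val
      have hS1 : (1 : GL (Fin n) 𝔸) ∈ S := ⟨1, subset_closure one_mem_colRangeTateDomain, rfl⟩
      have hSU : S ⊆ (adelicColRange n K (n - (k + 1)) (n - 1) : Set (GL (Fin n) 𝔸)) := by
        rintro _ ⟨y, -, rfl⟩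
        exact unipotentColRange_mono le_rfl (by omega) y.2
      have h1 : (1 : GL (Fin n) 𝔸) ∈ 𝒞 * S := by simpa using Set.mul_mem_mul h𝒞1 hS1
      refine ⟨𝒞 * S, h𝒞c.mul hSc, h1, ?_, fun φ g c hyp => ?_⟩
      · refine Set.mul_subset_iff.2 fun u hu y hy => ?_
        exact (adelicColRange n K (n - (k + 1)) (n - 1)).mul_mem
          (unipotentColRange_mono (by omega) le_rfl (h𝒞U hu)) (hSU hy)
      · have e : whittakerIter (K := K) (k + 1) φ g =
            colTransform (n - (k + 1)) h.1 h.2 (whittakerIter k φ) g := by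
          simp only [whittakerIter, dif_pos h]
        rw [e]
        have hc0 : 0 ≤ c := by
          have h1' := hyp 1 h1
          rw [one_mul] at h1'
          exact (norm_nonneg _).trans h1'
        refine norm_colTransform_le_of_box _ h.1 h.2 hc0 g fun y hy => ?_
        refine h𝒞b φ ((y : GL (Fin n) 𝔸) * g) c fun u hu => ?_
        rw [← mul_assoc]
        exact hyp (u * y) (Set.mul_mem_mul hu ⟨y, subset_closure hy, rfl⟩)
    · refine ⟨𝒞, h𝒞c, h𝒞1, fun u hu => unipotentColRange_mono (by omega) le_rfl (h𝒞U hu),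
        fun φ g c hyp => ?_⟩
      have e : whittakerIter (K := K) (k + 1) φ g = whittakerIter k φ g := by
        simp only [whittakerIter, dif_neg h]
      rw [e]
      exact h𝒞b φ g c hyp

/-- **The orbit bound for `Φ_d = whittakerDepth d φ`** (working form): a compact `𝒞 ∋ 1` of upper
unitriangular matrices with trivial columns `j ≤ d` such that `(∀ u ∈ 𝒞, ‖φ (u g)‖ ≤ c) → ‖Φ_d(g)‖ ≤ c`
(`exists_orbit_set_whittakerIter` at `k = n - 1 - d`: the set lies in `U_{[d+1, n-1]}(𝔸_K)`;
Cogdell (2004), §1.1, proof of Thm. 1.1). [folklore] -/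
theorem exists_orbit_set_whittakerDepth (d : ℕ) :
    ∃ 𝒞 : Set (GL (Fin n) 𝔸), IsCompact 𝒞 ∧ (1 : GL (Fin n) 𝔸) ∈ 𝒞 ∧
      𝒞 ⊆ (upperUnitriangular (Fin n) 𝔸 : Set (GL (Fin n) 𝔸)) ∧
      (∀ u ∈ 𝒞, ∀ i j : Fin n, (j : ℕ) ≤ d → i ≠ j →
        ((u : GL (Fin n) 𝔸) : Matrix (Fin n) (Fin n) 𝔸) i j = 0) ∧
      ∀ (φ : GL (Fin n) 𝔸 → ℂ) (g : GL (Fin n) 𝔸) (c : ℝ),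
        (∀ u ∈ 𝒞, ‖φ (u * g)‖ ≤ c) → ‖whittakerDepth d φ g‖ ≤ c := by
  obtain ⟨𝒞, h𝒞c, h𝒞1, h𝒞U, h𝒞b⟩ := exists_orbit_set_whittakerIter (n := n) (K := K) (n - 1 - d)
  refine ⟨𝒞, h𝒞c, h𝒞1, fun u hu => unipotentColRange_le_upperUnitriangular (h𝒞U hu),
    fun u hu i j hj hij => ?_, fun φ g c hyp => h𝒞b φ g c hyp⟩
  exact (mem_unipotentColRange_iff.1 (h𝒞U hu)).2 i j hij fun hin => by
    have h1 := hin.1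
    have h2 := j.2
    omega

end Main

/-- **E4: the orbit bound for the partial Whittaker transforms** (registered form of
`exists_orbit_set_whittakerDepth`): for every depth `d` there is a compact set `𝒞 ∋ 1` of upper
unitriangular matrices of `GL_n(𝔸_K)` whose columns `j ≤ d` are the standard basis vectors such that
`(∀ u ∈ 𝒞, ‖φ (u g)‖ ≤ c) → ‖whittakerDepth d φ g‖ ≤ c` for every `φ`, `g`, `c`
(Cogdell (2004), §1.1, proof of Thm. 1.1; Moeglin–Waldspurger (1995), I.2.10). [folklore] -/
theorem stub_decay_orbit_bound :
    ∀ {n : ℕ} {K : Type} [Field K] [NumberField K] (d : ℕ),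
      ∃ 𝒞 : Set (GL (Fin n) (AdeleRing (𝓞 K) K)), IsCompact 𝒞 ∧ (1 : GL (Fin n) (AdeleRing (𝓞 K) K)) ∈ 𝒞 ∧
        𝒞 ⊆ (upperUnitriangular (Fin n) (AdeleRing (𝓞 K) K) : Set (GL (Fin n) (AdeleRing (𝓞 K) K))) ∧
        (∀ u ∈ 𝒞, ∀ i j : Fin n, (j : ℕ) ≤ d → i ≠ j →
          ((u : GL (Fin n) (AdeleRing (𝓞 K) K)) : Matrix (Fin n) (Fin n) (AdeleRing (𝓞 K) K)) i j = 0) ∧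
        ∀ (φ : GL (Fin n) (AdeleRing (𝓞 K) K) → ℂ) (g : GL (Fin n) (AdeleRing (𝓞 K) K)) (c : ℝ),
          (∀ u ∈ 𝒞, ‖φ (u * g)‖ ≤ c) → ‖whittakerDepth d φ g‖ ≤ c := by
  intro n K _ _ d
  exact exists_orbit_set_whittakerDepth d

end Summit.Langlands.Langlands.Theorems.GapDecayOrbitBound

end
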